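import Literature.Probability.RandomPlanarGeometry.HexSAWBrickWallBridgeSurgery
import HarnessLib

/-!
# Hexagon surgery restricted to bridges of the honeycomb lattice: the band defect and the bookkeeping constants

Topic `Literature/Probability/RandomPlanarGeometry` (lane «pcv-sawmu», route R76 «HEX-BRIDGE-RATIO-2»; continues
`HexSAWBrickWallBridgeSurgery.lean`). Source: N. Madras, G. Slade, *The Self-Avoiding Walk* (1993), §7.3, proof of
Theorem 7.3.2, p. 245 (the bookkeeping of insertion sites and deletion sites under one insertion).

THE BAND DEFECT: a deletion site `(m, v)` of a bridge whose new vertex `v` is not in the band `(0, ht ω_N]` has `m = 0`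
and `ht v = 0` — for `m ≥ 1` the vertices `ω_m ≠ ω_{m+4}` would both be the unique neighbour of `v` one level up (or one
level down), since a vertex of `ℍ` has exactly one neighbour at each level offset `−1, 0, +1`. Hence `J(ω) ≤ J_B(ω) + 1`
and H-BASE's constants carry over with `+1`: `J_B(ω) ≤ J_B(ω') + 25`, `J_B(ω') ≤ J_B(ω) + 25`; and the slot-survival
injection of H-BASE's `card_hexSlots_le_hexIns` preserves the band (same three new vertices), giving
`I_B(ω) ≤ I_B(ω') + 324`. (The finite-geometry helper bounds of H-BASE are private there; they are re-proved here as
private lemmas, verbatim.) Status in print: as for `HexSAWBrickWallBridgeSurgery.lean`.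

## Contents (namespace `Literature.Probability.RandomPlanarGeometry.SAW.HV`; all PROVED, axioms standard)

* **`fst_eq_zero_of_not_inBand`**, **`card_hexSharp_le_card_bSharp_add_one : J ≤ J_B + 1`**;
* `one_le_card_bSharp_hexIns`, `card_bSharp_le_hexIns` (`J_B ≤ J_B' + 25`), `card_bSharp_hexIns_le` (`J_B' ≤ J_B + 25`),
  **`card_bSlots_le_hexIns`** (`I_B ≤ I_B' + 324`).
-/

noncomputable section

open Finset Literature.Probability.LatticeModels SimpleGraph
open scoped BigOperators

namespace Literature.Probability.RandomPlanarGeometry.SAW.HV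

/-! ### Bookkeeping for bridges: the band defect is at most one, and H-BASE's constants carry over -/

section Helpers

variable {N : ℕ} {ω : List HV}

/-- Membership in `hexNb` is adjacency. (private helper copied from
`HexSAWHexagonSurgery.lean`, where it is private) [folklore] -/
private theorem mem_hexNb {u v : HV} : v ∈ hexNb u ↔ hvGraph.Adj u v := by
  rw [hexNb, List.mem_toFinset, hvGraph_adj_iff_mem_nbrs]

/-- A vertex of `ℍ` has at most three neighbours. (private helper copied from
`HexSAWHexagonSurgery.lean`, where it is private) [folklore] -/
private theorem card_hexNb_le (u : HV) : #(hexNb u) ≤ 3 := by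
  refine (List.toFinset_card_le _).trans ?_
  obtain ⟨a, b, c⟩ := u
  cases c <;> simp [nbrs]

/-- Membership in `hexChain3`. (private helper copied from
`HexSAWHexagonSurgery.lean`, where it is private) [folklore] -/
private theorem mem_hexChain3 {u x y z : HV} :
    (x, y, z) ∈ hexChain3 u ↔ hvGraph.Adj u x ∧ hvGraph.Adj x y ∧ hvGraph.Adj y z := by
  simp only [hexChain3, mem_biUnion, mem_image, Prod.mk.injEq, mem_hexNb]
  constructor
  · rintro ⟨x', hx', y', hy', z', hz', rfl, rfl, rfl⟩
    exact ⟨hx', hy', hz'⟩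
  · rintro ⟨hx, hy, hz⟩
    exact ⟨x, hx, y, hy, z, hz, rfl, rfl, rfl⟩

/-- There are at most `27` such chains. (private helper copied from
`HexSAWHexagonSurgery.lean`, where it is private) [folklore] -/
private theorem card_hexChain3_le (u : HV) : #(hexChain3 u) ≤ 27 := by
  unfold hexChain3
  calc #((hexNb u).biUnion fun x => (hexNb x).biUnion fun y => (hexNb y).image fun z => (x, y, z))
      ≤ ∑ x ∈ hexNb u, #((hexNb x).biUnion fun y => (hexNb y).image fun z => (x, y, z)) := card_biUnion_le
    _ ≤ ∑ x ∈ hexNb u, 9 := by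
        refine sum_le_sum fun x _ => card_biUnion_le.trans ?_
        calc ∑ y ∈ hexNb x, #((hexNb y).image fun z => (x, y, z)) ≤ ∑ y ∈ hexNb x, 3 :=
              sum_le_sum fun y _ => card_image_le.trans (card_hexNb_le y)
          _ ≤ 9 := by rw [sum_const, smul_eq_mul]; have := card_hexNb_le x; omega
    _ ≤ 27 := by rw [sum_const, smul_eq_mul]; have := card_hexNb_le u; omega

/-- The positions at which the walk visits a neighbour of `t`: at most `3`. (private helper copied from
`HexSAWHexagonSurgery.lean`, where it is private) [folklore] -/
private theorem card_filter_getD_adj_le (hω : ω ∈ sawFin hvOrigin N) (t : HV) :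
    #((range (N + 1)).filter fun i => hvGraph.Adj t (ω.getD i hvOrigin)) ≤ 3 := by
  refine le_trans ?_ (card_hexNb_le t)
  refine card_le_card_of_injOn (fun i => ω.getD i hvOrigin) (fun i hi => ?_) (fun i hi j hj e => ?_)
  · rw [mem_coe, mem_filter] at hi
    rw [mem_coe, mem_hexNb]
    exact hi.2
  · rw [mem_coe, mem_filter, mem_range] at hi hj
    exact getD_injOn_of_mem_sawFin hω hi.1 hj.1 e

/-- Slots at a fixed position: at most `27`. (private helper copied from
`HexSAWHexagonSurgery.lean`, where it is private) [folklore] -/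
private theorem card_hexSlots_filter_fst_eq_le (ω : List HV) (j : ℕ) :
    #((hexSlots ω).filter fun s => s.1 = j) ≤ 27 := by
  refine le_trans (card_le_card (t := (hexChain3 (ω.getD j hvOrigin)).image fun c => (j, c)) ?_)
    (card_image_le.trans (card_hexChain3_le (ω.getD j hvOrigin)))
  rintro ⟨j', x', y', z'⟩ hp
  rw [mem_filter] at hp
  obtain ⟨hp, rfl⟩ := hp
  obtain ⟨-, h1, h2, h3, -⟩ := mem_hexSlots.1 hp
  exact mem_image.2 ⟨(x', y', z'), mem_hexChain3.2 ⟨h1, h2, h3⟩, rfl⟩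

/-- Slots at positions in a window `[a, b]`: at most `27 (b + 1 − a)`. (private helper copied from
`HexSAWHexagonSurgery.lean`, where it is private) [folklore] -/
private theorem card_hexSlots_filter_fst_mem_Icc_le (ω : List HV) (a b : ℕ) :
    #((hexSlots ω).filter fun s => a ≤ s.1 ∧ s.1 ≤ b) ≤ 27 * (b + 1 - a) := by
  have hsub : ((hexSlots ω).filter fun s => a ≤ s.1 ∧ s.1 ≤ b) ⊆
      (Icc a b).biUnion fun j => (hexSlots ω).filter fun s => s.1 = j := by
    intro p hp
    rw [mem_filter] at hp
    exact mem_biUnion.2 ⟨p.1, mem_Icc.2 hp.2, mem_filter.2 ⟨hp.1, rfl⟩⟩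
  refine (card_le_card hsub).trans (card_biUnion_le.trans ?_)
  calc ∑ j ∈ Icc a b, #((hexSlots ω).filter fun s => s.1 = j) ≤ ∑ _j ∈ Icc a b, 27 :=
        sum_le_sum fun j _ => card_hexSlots_filter_fst_eq_le ω j
    _ = 27 * (b + 1 - a) := by rw [sum_const, Nat.card_Icc, smul_eq_mul, mul_comm]

/-- Slots whose first new vertex is `t`: at most `27`. (private helper copied from
`HexSAWHexagonSurgery.lean`, where it is private) [folklore] -/
private theorem card_hexSlots_filter_x_eq_le (hω : ω ∈ sawFin hvOrigin N) (t : HV) :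
    #((hexSlots ω).filter fun s => s.2.1 = t) ≤ 27 := by
  have hl := length_of_mem_sawFin hω
  set P := (range (N + 1)).filter fun i => hvGraph.Adj t (ω.getD i hvOrigin) with hP
  set T := (P ×ˢ ((hexNb t).biUnion fun y' => (hexNb y').image fun z' => (y', z'))).image
    fun q : ℕ × HV × HV => (q.1, t, q.2.1, q.2.2) with hT
  have hsub : ((hexSlots ω).filter fun s => s.2.1 = t) ⊆ T := by
    rintro ⟨i, x', y', z'⟩ hs
    rw [mem_filter] at hs
    obtain ⟨hs, rfl⟩ := hs
    obtain ⟨hi, h1, h2, h3, -⟩ := mem_hexSlots.1 hs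
    rw [hT, mem_image]
    refine ⟨(i, y', z'), mem_product.2 ⟨mem_filter.2 ⟨mem_range.2 (by omega), h1.symm⟩,
      mem_biUnion.2 ⟨y', mem_hexNb.2 h2, mem_image.2 ⟨z', mem_hexNb.2 h3, rfl⟩⟩⟩, rfl⟩
  refine (card_le_card hsub).trans (card_image_le.trans ?_)
  rw [card_product]
  have hP3 : #P ≤ 3 := card_filter_getD_adj_le hω t
  have h9 : #((hexNb t).biUnion fun y' => (hexNb y').image fun z' => (y', z')) ≤ 9 := by
    refine card_biUnion_le.trans ?_
    calc ∑ y' ∈ hexNb t, #((hexNb y').image fun z' => (y', z')) ≤ ∑ _y' ∈ hexNb t, 3 :=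
          sum_le_sum fun y' _ => card_image_le.trans (card_hexNb_le y')
      _ ≤ 9 := by rw [sum_const, smul_eq_mul]; have := card_hexNb_le t; omega
  calc #P * #((hexNb t).biUnion fun y' => (hexNb y').image fun z' => (y', z')) ≤ 3 * 9 :=
        Nat.mul_le_mul hP3 h9
    _ = 27 := by norm_num

/-- Slots whose middle new vertex is `t`: at most `27`. (private helper copied from
`HexSAWHexagonSurgery.lean`, where it is private) [folklore] -/
private theorem card_hexSlots_filter_y_eq_le (hω : ω ∈ sawFin hvOrigin N) (t : HV) :
    #((hexSlots ω).filter fun s => s.2.2.1 = t) ≤ 27 := by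
  have hl := length_of_mem_sawFin hω
  set P : HV → Finset ℕ := fun x' => (range (N + 1)).filter fun i => hvGraph.Adj x' (ω.getD i hvOrigin) with hP
  set T := (((hexNb t).biUnion fun x' => (P x').image fun i => (i, x')) ×ˢ hexNb t).image
    fun q : (ℕ × HV) × HV => (q.1.1, q.1.2, t, q.2) with hT
  have hsub : ((hexSlots ω).filter fun s => s.2.2.1 = t) ⊆ T := by
    rintro ⟨i, x', y', z'⟩ hs
    rw [mem_filter] at hs
    obtain ⟨hs, rfl⟩ := hs
    obtain ⟨hi, h1, h2, h3, -⟩ := mem_hexSlots.1 hs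
    rw [hT, mem_image]
    refine ⟨((i, x'), z'), mem_product.2 ⟨mem_biUnion.2 ⟨x', mem_hexNb.2 h2.symm,
      mem_image.2 ⟨i, mem_filter.2 ⟨mem_range.2 (by omega), h1.symm⟩, rfl⟩⟩, mem_hexNb.2 h3⟩, rfl⟩
  refine (card_le_card hsub).trans (card_image_le.trans ?_)
  rw [card_product]
  have h9 : #((hexNb t).biUnion fun x' => (P x').image fun i => (i, x')) ≤ 9 := by
    refine card_biUnion_le.trans ?_
    calc ∑ x' ∈ hexNb t, #((P x').image fun i => (i, x')) ≤ ∑ _x' ∈ hexNb t, 3 :=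
          sum_le_sum fun x' _ => card_image_le.trans (card_filter_getD_adj_le hω x')
      _ ≤ 9 := by rw [sum_const, smul_eq_mul]; have := card_hexNb_le t; omega
  calc #((hexNb t).biUnion fun x' => (P x').image fun i => (i, x')) * #(hexNb t) ≤ 9 * 3 :=
        Nat.mul_le_mul h9 (card_hexNb_le t)
    _ = 27 := by norm_num

/-- Slots whose last new vertex is `t`: at most `27`. (private helper copied from
`HexSAWHexagonSurgery.lean`, where it is private) [folklore] -/
private theorem card_hexSlots_filter_z_eq_le (hω : ω ∈ sawFin hvOrigin N) (t : HV) :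
    #((hexSlots ω).filter fun s => s.2.2.2 = t) ≤ 27 := by
  have hl := length_of_mem_sawFin hω
  set P : HV → Finset ℕ := fun x' => (range (N + 1)).filter fun i => hvGraph.Adj x' (ω.getD i hvOrigin) with hP
  set T := ((hexNb t).biUnion fun y' => (hexNb y').biUnion fun x' => (P x').image fun i => (i, x', y', t))
    with hT
  have hsub : ((hexSlots ω).filter fun s => s.2.2.2 = t) ⊆ T := by
    rintro ⟨i, x', y', z'⟩ hs
    rw [mem_filter] at hs
    obtain ⟨hs, rfl⟩ := hs
    obtain ⟨hi, h1, h2, h3, -⟩ := mem_hexSlots.1 hs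
    rw [hT]
    exact mem_biUnion.2 ⟨y', mem_hexNb.2 h3.symm, mem_biUnion.2 ⟨x', mem_hexNb.2 h2.symm,
      mem_image.2 ⟨i, mem_filter.2 ⟨mem_range.2 (by omega), h1.symm⟩, rfl⟩⟩⟩
  refine (card_le_card hsub).trans (card_biUnion_le.trans ?_)
  calc ∑ y' ∈ hexNb t, #((hexNb y').biUnion fun x' => (P x').image fun i => (i, x', y', t))
      ≤ ∑ _y' ∈ hexNb t, 9 := by
        refine sum_le_sum fun y' _ => card_biUnion_le.trans ?_
        calc ∑ x' ∈ hexNb y', #((P x').image fun i => (i, x', y', t)) ≤ ∑ _x' ∈ hexNb y', 3 :=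
              sum_le_sum fun x' _ => card_image_le.trans (card_filter_getD_adj_le hω x')
          _ ≤ 9 := by rw [sum_const, smul_eq_mul]; have := card_hexNb_le y'; omega
    _ ≤ 27 := by rw [sum_const, smul_eq_mul]; have := card_hexNb_le t; omega

/-- Slots through a fixed vertex: at most `81`. (private helper copied from
`HexSAWHexagonSurgery.lean`, where it is private) [folklore] -/
private theorem card_hexSlots_filter_mem_le (hω : ω ∈ sawFin hvOrigin N) (t : HV) :
    #((hexSlots ω).filter fun s => s.2.1 = t ∨ s.2.2.1 = t ∨ s.2.2.2 = t) ≤ 81 := by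
  rw [filter_or, filter_or]
  have h1 := card_hexSlots_filter_x_eq_le hω t
  have h2 := card_hexSlots_filter_y_eq_le hω t
  have h3 := card_hexSlots_filter_z_eq_le hω t
  have h4 := card_union_le ((hexSlots ω).filter fun s => s.2.2.1 = t) ((hexSlots ω).filter fun s => s.2.2.2 = t)
  have h5 := card_union_le ((hexSlots ω).filter fun s => s.2.1 = t)
    (((hexSlots ω).filter fun s => s.2.2.1 = t) ∪ ((hexSlots ω).filter fun s => s.2.2.2 = t))
  omega


end Helpers

section BookkeepingB

variable {N : ℕ} {ω : List HV} {m : ℕ} {x y z v : HV}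

/-- **The band defect of a bridge is at most one**: a deletion site `(m, v)` of a bridge whose new vertex
`v` is NOT in the band `(0, ht ω_N]` has `m = 0` and `ht v = 0` (for `m ≥ 1` both `ω_m` and `ω_{m+4}` would be
the unique neighbour of `v` one level up, or one level down — contradicting self-avoidance).
[cite: MadrasSlade1993, §7.3 (proof of Theorem 7.3.2)] -/
theorem fst_eq_zero_of_not_inBand (hω : ω ∈ bridgeFin N) (hp : (m, v) ∈ hexSharp ω)
    (hv : ¬ InBand (top ω) v) : m = 0 ∧ ht v = 0 := by
  obtain ⟨hωS, hb⟩ := mem_bridgeFin.1 hω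
  obtain ⟨hml, h1, h2, -⟩ := mem_hexSharp.1 hp
  have hl := length_of_mem_sawFin hωS
  have htop : top ω = htAt ω N := top_eq hωS
  have hω0 : htAt ω 0 = 0 := htAt_zero hωS
  rw [htop] at hv
  simp only [InBand, not_and_or, not_lt, not_le] at hv
  simp only [IsBridgeL, htAt] at hb hω0 hv
  have a1 := ht_le_of_adj h1
  have a2 := ht_le_of_adj h2
  have b4 := hb (m + 4) (by omega) (by omega)
  rw [hω0] at b4
  have hne : ω.getD m hvOrigin ≠ ω.getD (m + 4) hvOrigin := fun e =>
    absurd (getD_injOn_of_mem_sawFin hωS (by omega) (by omega) e) (by omega)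
  rcases Nat.eq_zero_or_pos m with hm0 | hm0
  · subst hm0
    refine ⟨rfl, ?_⟩
    rw [hω0] at a1
    rcases hv with hv | hv <;> omega
  · have bm := hb m hm0 (by omega)
    rw [hω0] at bm
    exfalso
    rcases hv with hv | hv
    · -- `ht v ≤ 0`: both `ω_m`, `ω_{m+4}` sit one level above `v`
      exact hne (eq_of_adj_of_ht_eq_add_one h1.symm h2 (by omega) (by omega))
    · -- `ht v > top`: both `ω_m`, `ω_{m+4}` sit one level below `v`
      exact hne (eq_of_adj_of_ht_add_one_eq h1.symm h2 (by omega) (by omega))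

/-- `J(ω) ≤ J_B(ω) + 1` for a bridge: the non-admissible deletion sites form a subsingleton (the vertical
neighbour of the base vertex at position `0`). [cite: MadrasSlade1993, §7.3 (proof of Theorem 7.3.2)] -/
theorem card_hexSharp_le_card_bSharp_add_one (hω : ω ∈ bridgeFin N) : #(hexSharp ω) ≤ #(bSharp ω) + 1 := by
  obtain ⟨hωS, -⟩ := mem_bridgeFin.1 hω
  have hsplit := card_filter_add_card_filter_not (s := hexSharp ω) (p := fun p => InBand (top ω) p.2)
  have hbad : #((hexSharp ω).filter fun p => ¬ InBand (top ω) p.2) ≤ 1 := by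
    refine Finset.card_le_one.2 ?_
    rintro ⟨m, v⟩ hp ⟨m', v'⟩ hp'
    rw [mem_filter] at hp hp'
    obtain ⟨hm, hv0⟩ := fst_eq_zero_of_not_inBand hω hp.1 hp.2
    obtain ⟨hm', hv0'⟩ := fst_eq_zero_of_not_inBand hω hp'.1 hp'.2
    subst hm hm'
    obtain ⟨-, h1, -, -⟩ := mem_hexSharp.1 hp.1
    obtain ⟨-, h1', -, -⟩ := mem_hexSharp.1 hp'.1
    have h0 : ht (ω.getD 0 hvOrigin) = 0 := htAt_zero hωS
    simp only [Prod.mk.injEq, true_and]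
    exact eq_of_adj_of_ht_eq h1 h1' (by omega) (by omega)
  have e : (hexSharp ω).filter (fun p => InBand (top ω) p.2) = bSharp ω := rfl
  rw [e] at hsplit
  omega

/-- After an admissible insertion into a bridge the new bridge has an admissible deletion site: `1 ≤ J_B(ω')`.
[cite: MadrasSlade1993, §7.3 (proof of Theorem 7.3.2)] -/
theorem one_le_card_bSharp_hexIns (hω : ω ∈ bridgeFin N) (hs : (m, x, y, z) ∈ bSlots ω) :
    1 ≤ #(bSharp (hexIns m x y z ω)) :=
  card_pos.2 ⟨_, mem_bSharp_hexIns hω hs⟩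

/-- `J_B(ω) ≤ J_B(ω') + 25` (H-BASE's `J(ω) ≤ J(ω') + 24` and the band defect).
[cite: MadrasSlade1993, §7.3 (proof of Theorem 7.3.2), p. 245] -/
theorem card_bSharp_le_hexIns (hω : ω ∈ bridgeFin N) (hs : (m, x, y, z) ∈ bSlots ω) :
    #(bSharp ω) ≤ #(bSharp (hexIns m x y z ω)) + 25 := by
  obtain ⟨hωS, -⟩ := mem_bridgeFin.1 hω
  have hs0 := bSlots_subset ω hs
  have h1 := card_bSharp_le ω
  have h2 := card_hexSharp_le_hexIns hωS hs0
  have h3 := card_hexSharp_le_card_bSharp_add_one (hexIns_mem_bridgeFin hω hs)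
  omega

/-- `J_B(ω') ≤ J_B(ω) + 25` (H-BASE's `J(ω') ≤ J(ω) + 24` and the band defect).
[cite: MadrasSlade1993, §7.3 (proof of Theorem 7.3.2), p. 245] -/
theorem card_bSharp_hexIns_le (hω : ω ∈ bridgeFin N) (hs : (m, x, y, z) ∈ bSlots ω) :
    #(bSharp (hexIns m x y z ω)) ≤ #(bSharp ω) + 25 := by
  obtain ⟨hωS, -⟩ := mem_bridgeFin.1 hω
  have hs0 := bSlots_subset ω hs
  have h1 := card_bSharp_le (hexIns m x y z ω)
  have h2 := card_hexSharp_hexIns_le hωS hs0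
  have h3 := card_hexSharp_le_card_bSharp_add_one hω
  omega

/-- `I_B(ω) ≤ I_B(ω') + 324`: an admissible slot `(j, x', y', z')` of `ω` with `j ∉ {m−1, m, m+1}` and
`{x', y', z'}` disjoint from `{x, y, z}` is (shifted by `2` if `j ≥ m + 2`) an admissible slot of `hexIns m x y z ω`
(the band is unchanged). H-BASE's `card_hexSlots_le_hexIns`, restricted.
[cite: MadrasSlade1993, §7.3 (proof of Theorem 7.3.2), p. 245] -/
theorem card_bSlots_le_hexIns (hω : ω ∈ bridgeFin N) (hs : (m, x, y, z) ∈ bSlots ω) :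
    #(bSlots ω) ≤ #(bSlots (hexIns m x y z ω)) + 324 := by
  obtain ⟨hωS, -⟩ := mem_bridgeFin.1 hω
  have hs0 := bSlots_subset ω hs
  obtain ⟨hm, -, -, -, -, hxω, hyω, hzω, -⟩ := mem_hexSlots.1 hs0
  have hl := length_of_mem_sawFin hωS
  have htop : top (hexIns m x y z ω) = top ω := top_hexIns hωS hs0
  let bad : ℕ × HV × HV × HV → Prop := fun s => (m ≤ s.1 + 1 ∧ s.1 ≤ m + 1) ∨
    ((s.2.1 = x ∨ s.2.2.1 = x ∨ s.2.2.2 = x) ∨ (s.2.1 = y ∨ s.2.2.1 = y ∨ s.2.2.2 = y) ∨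
      (s.2.1 = z ∨ s.2.2.1 = z ∨ s.2.2.2 = z))
  set E := (bSlots ω).filter fun s => bad s with hE
  set K := (bSlots ω).filter fun s => ¬ bad s with hK
  have hsplit : #(bSlots ω) = #E + #K := (card_filter_add_card_filter_not _).symm
  have hE' : #E ≤ 324 := by
    have hsub : E ⊆ ((hexSlots ω).filter fun s => m - 1 ≤ s.1 ∧ s.1 ≤ m + 1) ∪
        (((hexSlots ω).filter fun s => s.2.1 = x ∨ s.2.2.1 = x ∨ s.2.2.2 = x) ∪
          (((hexSlots ω).filter fun s => s.2.1 = y ∨ s.2.2.1 = y ∨ s.2.2.2 = y) ∪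
            ((hexSlots ω).filter fun s => s.2.1 = z ∨ s.2.2.1 = z ∨ s.2.2.2 = z))) := by
      intro p hp
      rw [hE, mem_filter] at hp
      have hp1 : p ∈ hexSlots ω := bSlots_subset ω hp.1
      simp only [mem_union, mem_filter]
      rcases hp.2 with h | h | h | h
      · exact Or.inl ⟨hp1, by omega, h.2⟩
      · exact Or.inr (Or.inl ⟨hp1, h⟩)
      · exact Or.inr (Or.inr (Or.inl ⟨hp1, h⟩))
      · exact Or.inr (Or.inr (Or.inr ⟨hp1, h⟩))
    refine (card_le_card hsub).trans ((card_union_le _ _).trans ?_)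
    have h1 := card_hexSlots_filter_fst_mem_Icc_le ω (m - 1) (m + 1)
    have h2 := card_hexSlots_filter_mem_le hωS x
    have h3 := card_hexSlots_filter_mem_le hωS y
    have h4 := card_hexSlots_filter_mem_le hωS z
    have h5 := card_union_le ((hexSlots ω).filter fun s => s.2.1 = x ∨ s.2.2.1 = x ∨ s.2.2.2 = x)
      (((hexSlots ω).filter fun s => s.2.1 = y ∨ s.2.2.1 = y ∨ s.2.2.2 = y) ∪
        ((hexSlots ω).filter fun s => s.2.1 = z ∨ s.2.2.1 = z ∨ s.2.2.2 = z))
    have h6 := card_union_le ((hexSlots ω).filter fun s => s.2.1 = y ∨ s.2.2.1 = y ∨ s.2.2.2 = y)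
      ((hexSlots ω).filter fun s => s.2.1 = z ∨ s.2.2.1 = z ∨ s.2.2.2 = z)
    omega
  have hK' : #K ≤ #(bSlots (hexIns m x y z ω)) := by
    refine card_le_card_of_injOn (fun s => (if s.1 + 2 ≤ m then s.1 else s.1 + 2, s.2)) ?_ ?_
    · rintro ⟨j, x', y', z'⟩ hp
      rw [mem_coe, hK, mem_filter] at hp
      obtain ⟨hp, hne⟩ := hp
      obtain ⟨hp, hbx, hby, hbz⟩ := mem_bSlots.1 hp
      simp only [bad, not_or] at hne
      obtain ⟨hne1, ⟨hx1, hx2, hx3⟩, ⟨hy1, hy2, hy3⟩, ⟨hz1, hz2, hz3⟩⟩ := hne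
      obtain ⟨hj, ha1, ha2, ha3, ha4, hx', hy', hz', hxz'⟩ := mem_hexSlots.1 hp
      have hnot : ∀ {a : HV}, a ∉ ω → a ≠ x → a ≠ y → a ≠ z → a ∉ hexIns m x y z ω :=
        fun ha hax hay haz h => by
          rcases mem_hexIns h with e | e | e | e
          · exact hax e
          · exact hay e
          · exact haz e
          · exact ha e
      rw [mem_coe]
      dsimp only
      split_ifs with hjm
      · refine mem_bSlots.2 ⟨mem_hexSlots.2 ⟨by rw [length_hexIns (by omega)]; omega, ?_, ha2, ha3, ?_,
          hnot hx' hx1 hy1 hz1, hnot hy' hx2 hy2 hz2, hnot hz' hx3 hy3 hz3, hxz'⟩, ?_, ?_, ?_⟩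
        · rwa [getD_hexIns_of_le (by omega) (by omega)]
        · rwa [getD_hexIns_of_le (by omega) hjm]
        · rwa [htop]
        · rwa [htop]
        · rwa [htop]
      · have hj2 : m + 2 ≤ j := by omega
        refine mem_bSlots.2 ⟨mem_hexSlots.2 ⟨by rw [length_hexIns (by omega)]; omega, ?_, ha2, ha3, ?_,
          hnot hx' hx1 hy1 hz1, hnot hy' hx2 hy2 hz2, hnot hz' hx3 hy3 hz3, hxz'⟩, ?_, ?_, ?_⟩
        · rwa [getD_hexIns_of_ge (by omega) (by omega), show j + 2 - 2 = j by omega]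
        · rwa [getD_hexIns_of_ge (by omega) (by omega), show j + 2 + 2 - 2 = j + 2 by omega]
        · rwa [htop]
        · rwa [htop]
        · rwa [htop]
    · rintro ⟨j, c⟩ - ⟨j', c'⟩ - e
      simp only [Prod.mk.injEq] at e
      obtain ⟨e1, rfl⟩ := e
      have : j = j' := by split_ifs at e1 <;> omega
      rw [this]
  omega

end BookkeepingB

end Literature.Probability.RandomPlanarGeometry.SAW.HV
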